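import Literature.MathematicalPhysics.QuantumFieldTheory.Balaban1983to89.B9Thm313WholeDvAtPins
import Literature.MathematicalPhysics.QuantumFieldTheory.Balaban1983to89.B9Thm313WholeDvProbeAtPins

/-!
# `Balaban1983to89.B9Thm313WholeDvAtPinsR` — [B9] Theorems 3.12–3.13 (pp. 420–426): THE SIX D_U-RIGHT LETTERS OF ROWS 20–21 (G₀D_U : 𝔠_W⁽⁰⁾ → 𝔠⁽¹⁾,
# 𝔠_W⁽¹⁾ → 𝔠⁽²⁾; G₀D_U, ∇_{U,ν}G₀D_U, ∇_UG₀D_U in block L²; Φ^X_β∘G₀∘D_U) AT THE N06 CERTIFICATE'S PINS OVER ANY BACKGROUND CARRIER — the carrier-generic twins of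
# dag-n06-l's `B9Thm313WholeDvAtPins.gD1 ∕ gD2 ∕ gDv ∕ dGDvd ∕ dGDv_pins` and `B9Thm313WholeDvProbeAtPins.pXDv_pins` (there at the SU(N) member carrier `bg9Y` under
# MODULE 3's `Reg335`; here at `{B : B9.Backgrounds} (cfg : B.Cfg → CfgY …)` for every SU(N)-VALUED `cfg U`, as the class-parametric certificate editions need)

T. Bałaban, *Propagators for lattice gauge theories in a background field*, Commun. Math. Phys. **99** (1985) 389–434
[`Balaban1985BackgroundPropagators`, "B9"]; [4] = T. Bałaban, *Propagators and renormalization transformations for lattice gauge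
theories. II*, Commun. Math. Phys. **96** (1984) 223–250 [`Balaban1984PropagatorsII`].

statement-level skeleton of published theorems with citation tags; proofs where landed; nothing here is a claim about the Yang–Mills
mass gap

THE PRINTED LOCUS (held text `paper:balaban1985-cmp99-background-propagators`).  (3.3) p. 390 (the covariant gradient D_U of a scalar λ: a vector function
whose μ-component is ∇_{U,μ}λ); (3.8) p. 392 (∇\*_{U,μ}); Theorem 3.3 p. 399 with (3.42)–(3.43) pp. 397–398 (*"|(G(U)∇\*_UJ)(x)| ≦ B₀Lʲη·e^{−δ₀d(y,y′)}|J|"*,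
*"‖ζG(U)∇\*_Uλ‖_β ≦ B₀(β)(Lʲη)^{1−β}…"*), (3.46) p. 398 (the block-L² lines), p. 398 (remark after (3.47): *"we may always replace ∇_U by ∇\*_U … in arbitrary
place"*, and the transfer of one scale power by [4] Lemma 2.1); (3.133) p. 422, (3.152)–(3.153) p. 426 (the words G₀D_U, ∇_UG₀D_U of the expansions of H, H₁, 𝔊);
(3.35) p. 396 (*"U has values in G"*); [4] (2.51)–(2.56) pp. 232–233, Lemma 2.1 (2.60)–(2.61) p. 234.

THE POINT (dag-n06-c g21 LOCATED-23, cell bus 2026-08-29 23:21Z).  dag-n06-d's N06 certificate (edition 93 «UT», `Summits/…/BalabanUVNodesN06AtOpsYNuOfRecordV6EPairUT`)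
DERIVES Theorem 3.3 for G₀ in the direction-indexed currencies — `hG0C x … : Thm33G0Dir … ∧ Thm33G0DirR (𝔬12 x) (𝔡A x).Dsd 1 (H x) B12₀ δ12₀ U ∧ Thm33G0L2M …`
(`…N06G0LayerFromThm310AtPinsGUS.g0_layer_of_thm310_coreDir₃US`) — yet still DISPLAYS the D_U-right letters `hZ1` (= `Letters313Z.gD2`, G₀D_U : 𝔠_W⁽¹⁾ → 𝔠⁽²⁾),
`hpXDv` (`Letters313HZ.pXDv`, Φ^X_β∘G₀∘D_U) and, inside `hLL2`, `Letters313L2Pk.gDv ∕ .dGDv`, `Letters313L2MZ.dGDvd`.  dag-n06-l g17 typed the whole reduction: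
the algebra `B9Thm313WholeDvFromDds` (D_U = Σ_μ ∇\*_{U,μ}∘J_μ ⇒ G₀D_U = Σ_μ (G₀∇\*_{U,μ})∘J_μ, …; `gD1_of_e2d`, `gD2_of_e2d`, `gDv_l2_of_l2d`, `dGDvd_l2_of_l4m`,
`dGDv_l2_of_l4m`, `pXDv_of_h43Rd`), the kinematic letters at node00-def-Y's `DvcoKH ∕ DcoK` (`B9GradViaDivLettersAtPins(L2)`: `DvcoKH_eq_sum`, `DcoK_eq_sum`,
`hasMaj_JcoKH`, `blockBd_JcoKH`, `blockBd_sliceProjK` — generic in the carrier, needing only CONTRACTING link variables ‖u‖, ‖u⁻¹‖ ≦ 1) and the Φ^X-right slice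
relabelling `B9Thm313WholeDvProbeAtPins.h43Rd_of_pins` (dag-n06-w5's lemma; generic).  Only the member PACKAGES `…DvAtPins.*_pins` ∕ `…DvProbeAtPins.pXDv_pins` fixed
the carrier to MODULE 3's `bg9Y` and read the contraction off ITS `Reg335` — unusable in the class-parametric (`bg9YR R₁ R₂`) and print-class editions of record.  THIS
FILE re-presses the six packages ONCE over any background carrier `B` with a chart `cfg : B.Cfg → CfgY …` at an SU(N)-valued `cfg U` (dag-n06-l's own `…AtPinsR ∕ _pinsB`
convention of `B9LettersZQstarFieldsAtPinsR`): §0 `cfg_contracting_of_mem` (SU(N) ≦ U1; the empty index handled; `constJ_nonneg` is dag-n06-l's); §1 ★★ `gD1_pinsB`, ★★ `gD2_pinsB` (sup letters; `gD2`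
with the one-power transfer of p. 398 under the member facts `Facts347`); §2 ★★ `gDv_pinsB`, ★★ `dGDvd_pinsB`, ★★ `dGDv_pinsB` (block L²); §3 ★★ `pXDv_pinsB` (the
Hölder probe of G₀D_U from the bundled (3.43)₂ member of `Thm33G0Dir.h43R`'s shape, any probe transporter ∕ weights ∕ anchors — fits the certificate's `holderProbesKA`).
Statements and proofs are dag-n06-l's, verbatim up to `bg9Y ∕ hU ↦ B, cfg, hUG`.  The certificate's inputs: `he2d := (hG0C …).2.1.e2d`, `hl2d ∕ hl4m := (hG0C …).2.2.l2d ∕ .l4m`,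
`h43R := (hG0C …).1.h43R β`, `hUG := mem_of_reg335R hGR x hU`, pins `hblk12 hblkY12 hblkW12 hDvco12 hDco12 hG0co12 hDsco12 h𝔡Ad h𝔡As h𝔭A`; the member-uniform
thresholded package at rate `δ12₃ < δ12₀` is the companion `Summits/…/Theorems/BalabanUVNodesN06DvLettersLegAtPinsPU`.

HONEST SCOPE.  Kernel bookkeeping over landed modules (composition only); the directional Theorem-3.3-for-G₀ entries `he2d ∕ hl2d ∕ hl4m ∕ h43R` are HYPOTHESES (the
certificate's derived layer); nothing of print's estimates asserted; COUNT-NEUTRAL; N06 NOT discharged; one finite lattice at a time; nothing continuum, nothing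
about the mass gap.  Cell `pub-ymgap` (HUMAN RULING D-0062), Track A node N06 [B9], rows 20–21, seat `pub-ymgap-dag-n06-c` (g21), 2026-08-29; a NEW file; 0 `def`,
no `sorry`, no `axiom`, no `instance`, no `notation`.
-/

noncomputable section

namespace Literature.MathematicalPhysics.QuantumFieldTheory.Balaban1983to89.B9Thm313WholeDvAtPinsR

open Node00 B6GlobalChartV1 B6KLevelCensusIndexV1 B9BackgroundsKLevelV1
open B6Geom246MultiLevelTorus (geomT)
open B6Ineq2142KLevelV1 (β)
open B6RandomWalkHom (HasMajorantHom)
open B11SectG (HasMaj RowSum)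
open B9Thm34Ext (toB6)
open B9SectDL2Decay (BlockBd)
open B9Thm312Whole (cNorm GeoOK Ops)
open B9Thm312WholeClasses (cNormR)
open B9RWSums343Holder (HolderProbes)
open B9RWSums343to347Whole (Facts347)
open B9Thm39ReadingCoords (cR39 cR39_nonneg)
open B9GeoNormsKLevelV1 (geo9K)
open B9CoReadingCoords (XBK coordOpK cdBₗ cdsBₗ blkBK GcoK DscoK)
open B9CoReadingCoordsS (XSK blkSK sIK)
open B9CoReadingCoordsHolder (PK blkPK probeK)
open B9CoReadingCoordsTranspose (TrIdx trBasis)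
open B9PinMembersKLevelV1 (MemberY geo9Y)
open B7Prop2SpecialUnitary (specialUnitaryUnits specialUnitaryUnits_le_U1)
open Node00.OpsYSectDCoords (DvcoKH)
open B9GradViaDivLettersAtPins (JcoKH rJ sliceProjK DvcoKH_eq_sum DcoK_eq_sum hasMaj_JcoKH)
open B9GradViaDivLettersAtPinsL2 (blockBd_JcoKH blockBd_sliceProjK)
open B9Thm313WholeDvFromDds (gD1_of_e2d gD2_of_e2d gDv_l2_of_l2d dGDvd_l2_of_l4m dGDv_l2_of_l4m pXDv_of_h43Rd)
open B9Thm313WholeDvProbeAtPins (h43Rd_of_pins)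
open B9Thm313WholeDvAtPins (constJ_nonneg)
open scoped Matrix.Norms.L2Operator

variable {d ℓ : ℕ} {hd : 1 ≤ d + 1} {hL : Odd (ℓ + 1) ∧ 1 < ℓ + 1} {b₀ b₁ : ℝ} {Mstar : ℕ} {N : ℕ}

/-! ## §0 SU(N)-valued link variables are contracting -/

/-- **AN SU(N)-VALUED CONFIGURATION HAS CONTRACTING LINK VARIABLES** (`‖u‖, ‖u⁻¹‖ ≤ 1`, `B7Prop2SpecialUnitary.specialUnitaryUnits_le_U1`; the empty index type is
trivial) — the `hU` input of `B9GradViaDivLettersAtPins.hasMaj_JcoKH ∕ …L2.blockBd_JcoKH` read off «`U` has values in `G`».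
[cite: Balaban1985BackgroundPropagators, (3.35) p.396 («U has values in G»)] -/
theorem cfg_contracting_of_mem (i : KIdx d ℓ hd hL b₀ b₁) {B : B9.Backgrounds} (cfg : B.Cfg → CfgY (Matrix (Fin N) (Fin N) ℂ) i) {U : B.Cfg}
    (hUG : ∀ μ z, cfg U μ z ∈ specialUnitaryUnits (Fin N)) (ν : Fin (d + 1)) (s : Site (PV d ℓ i.m i.K hd hL) 0) :
    ‖(cfg U ν s : Matrix (Fin N) (Fin N) ℂ)‖ ≤ 1 ∧ ‖(((cfg U ν s)⁻¹ : (Matrix (Fin N) (Fin N) ℂ)ˣ) : Matrix (Fin N) (Fin N) ℂ)‖ ≤ 1 := by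
  rcases isEmpty_or_nonempty (Fin N) with hN | hN
  · have h0 : ∀ A : Matrix (Fin N) (Fin N) ℂ, ‖A‖ ≤ 1 := fun A => by rw [Subsingleton.elim A 0, norm_zero]; exact zero_le_one
    exact ⟨h0 _, h0 _⟩
  · exact specialUnitaryUnits_le_U1 (hUG ν s)

variable [∀ x : MemberY d ℓ hd hL b₀ b₁ Mstar, Fintype (geo9Y x).Site]

/-! ## §1 The sup letters: G₀D_U : 𝔠_W⁽⁰⁾ → 𝔠⁽¹⁾ and 𝔠_W⁽¹⁾ → 𝔠⁽²⁾, any carrier -/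

/-- ★★ **`Letters313Z.gD1` AT THE PINS, ANY CARRIER** — G₀D_U : 𝔠_W⁽⁰⁾ → 𝔠⁽¹⁾ with `B₃ ≥ (d+1)·B₀·C_J·c`, `0 ≤ δ₃ ≤ δ₀`, `δ₃ + σ ≤ δ_J`, from the derived
`Thm33G0DirR.e2d` at the pinned direction letters, every member, every SU(N)-valued `cfg U` of any carrier (dag-n06-l's `gD1_pins`, carrier-generic).
[cite: Balaban1985BackgroundPropagators, Thm 3.3 (3.42) p.397, (3.133) p.422, (3.3) p.390, (3.35) p.396; Balaban1984PropagatorsII, (2.52)–(2.56) pp.232–233, Lemma 2.1 (2.61) p.234] -/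
theorem gD1_pinsB (x : MemberY d ℓ hd hL b₀ b₁ Mstar) {bI : FBondY x.toKIdx → IBondY x.toKIdx}
    (hβ1 : ∀ f : FBondY x.toKIdx, (geomT x.D).dist (β x.hN x.D x.hk (bI f)) (blkV1 x.hN x.D f) ≤ 1)
    {Z : Type} [Fintype Z] {B : B9.Backgrounds} {cfg : B.Cfg → CfgY (Matrix (Fin N) (Fin N) ℂ) x.toKIdx}
    {U : B.Cfg} (hUG : ∀ μ z, cfg U μ z ∈ specialUnitaryUnits (Fin N))
    {R₀ : ℝ} {H₀ : Prop} (hG : GeoOK (geo9Y x)) {σ c : ℝ} (hrow : RowSum (toB6 (geo9Y x) R₀ H₀) σ c)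
    (𝔬 : Ops (geo9Y x) B (XBK (TrIdx N) x.toKIdx) (XBK (TrIdx N) x.toKIdx) Z (XSK (TrIdx N) x.toKIdx))
    (hblk : 𝔬.blk = blkBK x.toKIdx bI) (hblkW : 𝔬.blkW = blkSK x.toKIdx (sIK x.toKIdx bI))
    (hDv : 𝔬.Dv U = DvcoKH x.toKIdx (trBasis N) B cfg U)
    {Dds : Fin (d + 1) → Module.End ℝ (XBK (TrIdx N) x.toKIdx → ℝ)}
    (hDds : Dds = fun μ => coordOpK (trBasis N) (fun _ : Fin (d + 1) => cdsBₗ x.toKIdx (cfg U) μ))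
    {B₀ δ₀ δJ B₃ δ₃ : ℝ} (hB₀ : 0 ≤ B₀) (hδJ : 0 ≤ δJ) (hδ₃ : 0 ≤ δ₃) (hδ₃0 : δ₃ ≤ δ₀) (hδ₃J : δ₃ + σ ≤ δJ)
    (hB₃ : ((d : ℝ) + 1) * (B₀ * (cR39 (trBasis N) * Real.exp (δJ * rJ d ℓ)) * c) ≤ B₃)
    (he2d : ∀ μ, HasMajorantHom (g := toB6 (geo9Y x) R₀ H₀) 𝔬.blk 𝔬.blk (𝔬.G0 U ∘ₗ Dds μ)
      (fun (a b : (geo9Y x).Site) => B₀ * (geo9Y x).len a * Real.exp (-(δ₀ * (geo9Y x).dist a b)))) :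
    HasMaj (cNorm R₀ H₀ 𝔬.blkW hG.lenle 0) (cNorm R₀ H₀ 𝔬.blk hG.lenle 1) (𝔬.G0 U ∘ₗ 𝔬.Dv U)
      (fun a b => B₃ * Real.exp (-(δ₃ * (geo9Y x).dist a b))) := by
  letI : Fintype (geo9K x.toKIdx).Site := (inferInstance : Fintype (geo9Y x).Site)
  have hDv' : 𝔬.Dv U = ∑ μ, Dds μ ∘ₗ JcoKH x.toKIdx (trBasis N) B cfg μ U := by
    rw [hDv, hDds]
    exact DvcoKH_eq_sum x.toKIdx (trBasis N) B cfg U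
  have hJ : ∀ μ, HasMaj (cNorm R₀ H₀ 𝔬.blkW hG.lenle 0) (cNorm R₀ H₀ 𝔬.blk hG.lenle 0) (JcoKH x.toKIdx (trBasis N) B cfg μ U)
      (fun a b => cR39 (trBasis N) * Real.exp (δJ * rJ d ℓ) * Real.exp (-(δJ * (geo9Y x).dist a b))) := fun μ => by
    rw [hblk, hblkW]
    exact hasMaj_JcoKH x.toKIdx (trBasis N) B cfg hβ1 (cfg_contracting_of_mem x.toKIdx cfg hUG) hδJ hG.lenle μ
  have hB₃' : (Fintype.card (Fin (d + 1)) : ℝ) * (B₀ * (cR39 (trBasis N) * Real.exp (δJ * rJ d ℓ)) * c) ≤ B₃ := by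
    rw [Fintype.card_fin, Nat.cast_add, Nat.cast_one]; exact hB₃
  exact gD1_of_e2d hG hrow hB₀ (constJ_nonneg δJ) hδ₃ hδ₃0 hδ₃J hB₃' hDv' he2d hJ

/-- ★★ **`Letters313Z.gD2` AT THE PINS, ANY CARRIER (= the certificate's displayed `hZ1`)** — G₀D_U : 𝔠_W⁽¹⁾ → 𝔠⁽²⁾ with `B₃′ ≥ (d+1)·B₀·C_J·c·L₀`,
`δ₃′ ≤ δ₃ − αδ_F` under the member facts `Facts347` (the one-power transfer of p. 398), every SU(N)-valued `cfg U` of any carrier (dag-n06-l's `gD2_pins`,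
carrier-generic). [cite: Balaban1985BackgroundPropagators, Thm 3.3 (3.42) p.397, p.398 (remark after (3.47)), (3.133) p.422, (3.3) p.390, (3.35) p.396; Balaban1984PropagatorsII, (2.52)–(2.56) pp.232–233, Lemma 2.1 (2.60)–(2.61) p.234] -/
theorem gD2_pinsB (x : MemberY d ℓ hd hL b₀ b₁ Mstar) {bI : FBondY x.toKIdx → IBondY x.toKIdx}
    (hβ1 : ∀ f : FBondY x.toKIdx, (geomT x.D).dist (β x.hN x.D x.hk (bI f)) (blkV1 x.hN x.D f) ≤ 1)
    {Z : Type} [Fintype Z] {B : B9.Backgrounds} {cfg : B.Cfg → CfgY (Matrix (Fin N) (Fin N) ℂ) x.toKIdx}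
    {U : B.Cfg} (hUG : ∀ μ z, cfg U μ z ∈ specialUnitaryUnits (Fin N))
    {R₀ : ℝ} {H₀ : Prop} (hG : GeoOK (geo9Y x)) {σ c : ℝ} (hrow : RowSum (toB6 (geo9Y x) R₀ H₀) σ c)
    {dF : ℕ} {δF α L₀ : ℝ} (hF : Facts347 (geo9Y x) R₀ H₀ dF δF α L₀)
    (𝔬 : Ops (geo9Y x) B (XBK (TrIdx N) x.toKIdx) (XBK (TrIdx N) x.toKIdx) Z (XSK (TrIdx N) x.toKIdx))
    (hblk : 𝔬.blk = blkBK x.toKIdx bI) (hblkW : 𝔬.blkW = blkSK x.toKIdx (sIK x.toKIdx bI))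
    (hDv : 𝔬.Dv U = DvcoKH x.toKIdx (trBasis N) B cfg U)
    {Dds : Fin (d + 1) → Module.End ℝ (XBK (TrIdx N) x.toKIdx → ℝ)}
    (hDds : Dds = fun μ => coordOpK (trBasis N) (fun _ : Fin (d + 1) => cdsBₗ x.toKIdx (cfg U) μ))
    {B₀ δ₀ δJ δ₃ B₃' δ₃' : ℝ} (hB₀ : 0 ≤ B₀) (hc : 0 ≤ c) (hδJ : 0 ≤ δJ) (hδ₃ : 0 ≤ δ₃) (hδ₃0 : δ₃ ≤ δ₀) (hδ₃J : δ₃ + σ ≤ δJ)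
    (hB₃' : ((d : ℝ) + 1) * (B₀ * (cR39 (trBasis N) * Real.exp (δJ * rJ d ℓ)) * c) * L₀ ≤ B₃') (hδ₃' : δ₃' ≤ δ₃ - α * δF)
    (he2d : ∀ μ, HasMajorantHom (g := toB6 (geo9Y x) R₀ H₀) 𝔬.blk 𝔬.blk (𝔬.G0 U ∘ₗ Dds μ)
      (fun (a b : (geo9Y x).Site) => B₀ * (geo9Y x).len a * Real.exp (-(δ₀ * (geo9Y x).dist a b)))) :
    HasMaj (cNorm R₀ H₀ 𝔬.blkW hG.lenle 1) (cNorm R₀ H₀ 𝔬.blk hG.lenle 2) (𝔬.G0 U ∘ₗ 𝔬.Dv U)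
      (fun a b => B₃' * Real.exp (-(δ₃' * (geo9Y x).dist a b))) := by
  letI : Fintype (geo9K x.toKIdx).Site := (inferInstance : Fintype (geo9Y x).Site)
  have hDv' : 𝔬.Dv U = ∑ μ, Dds μ ∘ₗ JcoKH x.toKIdx (trBasis N) B cfg μ U := by
    rw [hDv, hDds]
    exact DvcoKH_eq_sum x.toKIdx (trBasis N) B cfg U
  have hJ : ∀ μ, HasMaj (cNorm R₀ H₀ 𝔬.blkW hG.lenle 0) (cNorm R₀ H₀ 𝔬.blk hG.lenle 0) (JcoKH x.toKIdx (trBasis N) B cfg μ U)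
      (fun a b => cR39 (trBasis N) * Real.exp (δJ * rJ d ℓ) * Real.exp (-(δJ * (geo9Y x).dist a b))) := fun μ => by
    rw [hblk, hblkW]
    exact hasMaj_JcoKH x.toKIdx (trBasis N) B cfg hβ1 (cfg_contracting_of_mem x.toKIdx cfg hUG) hδJ hG.lenle μ
  have hB₃'' : (Fintype.card (Fin (d + 1)) : ℝ) * (B₀ * (cR39 (trBasis N) * Real.exp (δJ * rJ d ℓ)) * c) * L₀ ≤ B₃' := by
    rw [Fintype.card_fin, Nat.cast_add, Nat.cast_one]; exact hB₃'
  exact gD2_of_e2d hG hrow hF hB₀ (constJ_nonneg δJ) hc hδ₃ hδ₃0 hδ₃J hB₃'' hδ₃' hDv' he2d hJ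

/-! ## §2 The block-L² letters: G₀D_U, ∇_{U,ν}G₀D_U, ∇_UG₀D_U, any carrier -/

/-- ★★ **`Letters313L2Pk.gDv` AT THE PINS, ANY CARRIER** — G₀D_U in block L² with `B₄ ≥ (d+1)·B₂·C_J·c`, `0 ≤ ρ ≤ δ₁`, `ρ + σ ≤ δ_J`, from the derived
`Thm33G0L2M.l2d`, every SU(N)-valued `cfg U` of any carrier (dag-n06-l's `gDv_pins`, carrier-generic).
[cite: Balaban1985BackgroundPropagators, (3.46) p.398, (3.153) p.426, (3.3) p.390, (3.35) p.396; Balaban1984PropagatorsII, (2.52)–(2.56) pp.232–233, Lemma 2.1 (2.61) p.234] -/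
theorem gDv_pinsB (x : MemberY d ℓ hd hL b₀ b₁ Mstar) {bI : FBondY x.toKIdx → IBondY x.toKIdx}
    (hβ1 : ∀ f : FBondY x.toKIdx, (geomT x.D).dist (β x.hN x.D x.hk (bI f)) (blkV1 x.hN x.D f) ≤ 1)
    {Z : Type} [Fintype Z] {B : B9.Backgrounds} {cfg : B.Cfg → CfgY (Matrix (Fin N) (Fin N) ℂ) x.toKIdx}
    {U : B.Cfg} (hUG : ∀ μ z, cfg U μ z ∈ specialUnitaryUnits (Fin N))
    {R₀ : ℝ} {H₀ : Prop} (hG : GeoOK (geo9Y x)) {σ c : ℝ} (hrow : RowSum (toB6 (geo9Y x) R₀ H₀) σ c)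
    (𝔬 : Ops (geo9Y x) B (XBK (TrIdx N) x.toKIdx) (XBK (TrIdx N) x.toKIdx) Z (XSK (TrIdx N) x.toKIdx))
    (hblk : 𝔬.blk = blkBK x.toKIdx bI) (hblkW : 𝔬.blkW = blkSK x.toKIdx (sIK x.toKIdx bI))
    (hDv : 𝔬.Dv U = DvcoKH x.toKIdx (trBasis N) B cfg U)
    {Dds : Fin (d + 1) → Module.End ℝ (XBK (TrIdx N) x.toKIdx → ℝ)}
    (hDds : Dds = fun μ => coordOpK (trBasis N) (fun _ : Fin (d + 1) => cdsBₗ x.toKIdx (cfg U) μ))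
    {B₂ δ₁ δJ B₄ ρ : ℝ} (hB₂ : 0 ≤ B₂) (hδJ : 0 ≤ δJ) (hρ : 0 ≤ ρ) (hρ₁ : ρ ≤ δ₁) (hρJ : ρ + σ ≤ δJ)
    (hB₄ : ((d : ℝ) + 1) * (B₂ * (cR39 (trBasis N) * Real.exp (δJ * rJ d ℓ)) * c) ≤ B₄)
    (hl2d : ∀ μ, BlockBd (g := toB6 (geo9Y x) R₀ H₀) 𝔬.blk 𝔬.blk (𝔬.G0 U ∘ₗ Dds μ)
      (fun (y y' : (geo9Y x).Site) => B₂ * (geo9Y x).len y * Real.exp (-(δ₁ * (geo9Y x).dist y y')))) :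
    BlockBd (g := toB6 (geo9Y x) R₀ H₀) 𝔬.blkW 𝔬.blk (𝔬.G0 U ∘ₗ 𝔬.Dv U)
      (fun (y y' : (geo9Y x).Site) => B₄ * (geo9Y x).len y * Real.exp (-(ρ * (geo9Y x).dist y y'))) := by
  letI : Fintype (geo9K x.toKIdx).Site := (inferInstance : Fintype (geo9Y x).Site)
  have hDv' : 𝔬.Dv U = ∑ μ, Dds μ ∘ₗ JcoKH x.toKIdx (trBasis N) B cfg μ U := by
    rw [hDv, hDds]
    exact DvcoKH_eq_sum x.toKIdx (trBasis N) B cfg U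
  have hJL2 : ∀ μ, BlockBd (g := toB6 (geo9Y x) R₀ H₀) 𝔬.blkW 𝔬.blk (JcoKH x.toKIdx (trBasis N) B cfg μ U)
      (fun y y' => cR39 (trBasis N) * Real.exp (δJ * rJ d ℓ) * Real.exp (-(δJ * (geo9Y x).dist y y'))) := fun μ => by
    rw [hblk, hblkW]
    exact blockBd_JcoKH x.toKIdx (trBasis N) B cfg hβ1 (cfg_contracting_of_mem x.toKIdx cfg hUG) hδJ R₀ H₀ μ
  have hB₄' : (Fintype.card (Fin (d + 1)) : ℝ) * (B₂ * (cR39 (trBasis N) * Real.exp (δJ * rJ d ℓ)) * c) ≤ B₄ := by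
    rw [Fintype.card_fin, Nat.cast_add, Nat.cast_one]; exact hB₄
  exact gDv_l2_of_l2d hG hrow hB₂ (constJ_nonneg δJ) hρ hρ₁ hρJ hB₄' hDv' hl2d hJL2

/-- ★★ **`Letters313L2MZ.dGDvd ν` AT THE PINS, ANY CARRIER** — ∇_{U,ν}G₀D_U in block L² with `B₄ ≥ (d+1)·B₂·C_J·c`, `0 ≤ ρ ≤ δ₁`, `ρ + σ ≤ δ_J`, from the
derived `Thm33G0L2M.l4m` at the pinned direction letters, every SU(N)-valued `cfg U` of any carrier (dag-n06-l's `dGDvd_pins`, carrier-generic).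
[cite: Balaban1985BackgroundPropagators, (3.46) p.398, (3.152)–(3.153) p.426, (3.3) p.390, (3.35) p.396; Balaban1984PropagatorsII, (2.52)–(2.56) pp.232–233, Lemma 2.1 (2.61) p.234] -/
theorem dGDvd_pinsB (x : MemberY d ℓ hd hL b₀ b₁ Mstar) {bI : FBondY x.toKIdx → IBondY x.toKIdx}
    (hβ1 : ∀ f : FBondY x.toKIdx, (geomT x.D).dist (β x.hN x.D x.hk (bI f)) (blkV1 x.hN x.D f) ≤ 1)
    {Z : Type} [Fintype Z] {B : B9.Backgrounds} {cfg : B.Cfg → CfgY (Matrix (Fin N) (Fin N) ℂ) x.toKIdx}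
    {U : B.Cfg} (hUG : ∀ μ z, cfg U μ z ∈ specialUnitaryUnits (Fin N))
    {R₀ : ℝ} {H₀ : Prop} (hG : GeoOK (geo9Y x)) {σ c : ℝ} (hrow : RowSum (toB6 (geo9Y x) R₀ H₀) σ c)
    (𝔬 : Ops (geo9Y x) B (XBK (TrIdx N) x.toKIdx) (XBK (TrIdx N) x.toKIdx) Z (XSK (TrIdx N) x.toKIdx))
    (hblk : 𝔬.blk = blkBK x.toKIdx bI) (hblkW : 𝔬.blkW = blkSK x.toKIdx (sIK x.toKIdx bI))
    (hDv : 𝔬.Dv U = DvcoKH x.toKIdx (trBasis N) B cfg U)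
    {Dd Dds : Fin (d + 1) → Module.End ℝ (XBK (TrIdx N) x.toKIdx → ℝ)}
    (hDds : Dds = fun μ => coordOpK (trBasis N) (fun _ : Fin (d + 1) => cdsBₗ x.toKIdx (cfg U) μ))
    {B₂ δ₁ δJ B₄ ρ : ℝ} (hB₂ : 0 ≤ B₂) (hδJ : 0 ≤ δJ) (hρ : 0 ≤ ρ) (hρ₁ : ρ ≤ δ₁) (hρJ : ρ + σ ≤ δJ)
    (hB₄ : ((d : ℝ) + 1) * (B₂ * (cR39 (trBasis N) * Real.exp (δJ * rJ d ℓ)) * c) ≤ B₄) (ν : Fin (d + 1))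
    (hl4m : ∀ μ, BlockBd (g := toB6 (geo9Y x) R₀ H₀) 𝔬.blk 𝔬.blk (Dd ν ∘ₗ (𝔬.G0 U ∘ₗ Dds μ))
      (fun (y y' : (geo9Y x).Site) => B₂ * Real.exp (-(δ₁ * (geo9Y x).dist y y')))) :
    BlockBd (g := toB6 (geo9Y x) R₀ H₀) 𝔬.blkW 𝔬.blk (Dd ν ∘ₗ 𝔬.G0 U ∘ₗ 𝔬.Dv U)
      (fun (y y' : (geo9Y x).Site) => B₄ * Real.exp (-(ρ * (geo9Y x).dist y y'))) := by
  letI : Fintype (geo9K x.toKIdx).Site := (inferInstance : Fintype (geo9Y x).Site)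
  have hDv' : 𝔬.Dv U = ∑ μ, Dds μ ∘ₗ JcoKH x.toKIdx (trBasis N) B cfg μ U := by
    rw [hDv, hDds]
    exact DvcoKH_eq_sum x.toKIdx (trBasis N) B cfg U
  have hJL2 : ∀ μ, BlockBd (g := toB6 (geo9Y x) R₀ H₀) 𝔬.blkW 𝔬.blk (JcoKH x.toKIdx (trBasis N) B cfg μ U)
      (fun y y' => cR39 (trBasis N) * Real.exp (δJ * rJ d ℓ) * Real.exp (-(δJ * (geo9Y x).dist y y'))) := fun μ => by
    rw [hblk, hblkW]
    exact blockBd_JcoKH x.toKIdx (trBasis N) B cfg hβ1 (cfg_contracting_of_mem x.toKIdx cfg hUG) hδJ R₀ H₀ μ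
  have hB₄' : (Fintype.card (Fin (d + 1)) : ℝ) * (B₂ * (cR39 (trBasis N) * Real.exp (δJ * rJ d ℓ)) * c) ≤ B₄ := by
    rw [Fintype.card_fin, Nat.cast_add, Nat.cast_one]; exact hB₄
  exact dGDvd_l2_of_l4m hG hrow hB₂ (constJ_nonneg δJ) hρ hρ₁ hρJ hB₄' hDv' hl4m hJL2

/-- ★★ **`Letters313L2Pk.dGDv` AT THE PINS, ANY CARRIER** — ∇_UG₀D_U in block L² (target block map `𝔬.blkY = 𝔬.blk` at the pins), the slice-diagonal ∇_U
of n06-d's `DcoK` written `Σ_ν Π_ν ∘ ∇_{U,ν}` (`DcoK_eq_sum`): `B₄ ≥ (d+1)²·B₂·C_J·c²`, `0 ≤ ρ ≤ δ₁`, `ρ + σ ≤ δ_J`, from the derived `Thm33G0L2M.l4m`, every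
SU(N)-valued `cfg U` of any carrier (dag-n06-l's `dGDv_pins`, carrier-generic).
[cite: Balaban1985BackgroundPropagators, (3.46) p.398, (3.152)–(3.153) p.426, (3.3) p.390, (3.35) p.396; Balaban1984PropagatorsII, (2.52)–(2.56) pp.232–233, Lemma 2.1 (2.61) p.234] -/
theorem dGDv_pinsB (x : MemberY d ℓ hd hL b₀ b₁ Mstar) {bI : FBondY x.toKIdx → IBondY x.toKIdx}
    (hβ1 : ∀ f : FBondY x.toKIdx, (geomT x.D).dist (β x.hN x.D x.hk (bI f)) (blkV1 x.hN x.D f) ≤ 1)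
    {Z : Type} [Fintype Z] {B : B9.Backgrounds} {cfg : B.Cfg → CfgY (Matrix (Fin N) (Fin N) ℂ) x.toKIdx}
    {U : B.Cfg} (hUG : ∀ μ z, cfg U μ z ∈ specialUnitaryUnits (Fin N))
    {R₀ : ℝ} {H₀ : Prop} (hG : GeoOK (geo9Y x)) {σ c : ℝ} (hrow : RowSum (toB6 (geo9Y x) R₀ H₀) σ c)
    (𝔬 : Ops (geo9Y x) B (XBK (TrIdx N) x.toKIdx) (XBK (TrIdx N) x.toKIdx) Z (XSK (TrIdx N) x.toKIdx))
    (hblk : 𝔬.blk = blkBK x.toKIdx bI) (hblkY : 𝔬.blkY = blkBK x.toKIdx bI) (hblkW : 𝔬.blkW = blkSK x.toKIdx (sIK x.toKIdx bI))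
    (hDv : 𝔬.Dv U = DvcoKH x.toKIdx (trBasis N) B cfg U)
    (hD : 𝔬.D U = B9CoReadingCoords.DcoK x.toKIdx (trBasis N) B cfg U)
    {Dd Dds : Fin (d + 1) → Module.End ℝ (XBK (TrIdx N) x.toKIdx → ℝ)}
    (hDd : Dd = fun ν => coordOpK (trBasis N) (fun _ : Fin (d + 1) => cdBₗ x.toKIdx (cfg U) ν))
    (hDds : Dds = fun μ => coordOpK (trBasis N) (fun _ : Fin (d + 1) => cdsBₗ x.toKIdx (cfg U) μ))
    {B₂ δ₁ δJ B₄ ρ : ℝ} (hB₂ : 0 ≤ B₂) (hc : 0 ≤ c) (hδJ : 0 ≤ δJ) (hρ : 0 ≤ ρ) (hρ₁ : ρ ≤ δ₁) (hρJ : ρ + σ ≤ δJ)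
    (hB₄ : ((d : ℝ) + 1) ^ 2 * (1 * (B₂ * (cR39 (trBasis N) * Real.exp (δJ * rJ d ℓ)) * c) * c) ≤ B₄)
    (hl4m : ∀ ν μ, BlockBd (g := toB6 (geo9Y x) R₀ H₀) 𝔬.blk 𝔬.blk (Dd ν ∘ₗ (𝔬.G0 U ∘ₗ Dds μ))
      (fun (y y' : (geo9Y x).Site) => B₂ * Real.exp (-(δ₁ * (geo9Y x).dist y y')))) :
    BlockBd (g := toB6 (geo9Y x) R₀ H₀) 𝔬.blkW 𝔬.blkY (𝔬.D U ∘ₗ 𝔬.G0 U ∘ₗ 𝔬.Dv U)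
      (fun (y y' : (geo9Y x).Site) => B₄ * Real.exp (-(ρ * (geo9Y x).dist y y'))) := by
  letI : Fintype (geo9K x.toKIdx).Site := (inferInstance : Fintype (geo9Y x).Site)
  have hDv' : 𝔬.Dv U = ∑ μ, Dds μ ∘ₗ JcoKH x.toKIdx (trBasis N) B cfg μ U := by
    rw [hDv, hDds]
    exact DvcoKH_eq_sum x.toKIdx (trBasis N) B cfg U
  have hD' : 𝔬.D U = ∑ ν, sliceProjK ν ∘ₗ Dd ν := by
    rw [hD, hDd]
    exact DcoK_eq_sum x.toKIdx (trBasis N) B cfg U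
  have hJL2 : ∀ μ, BlockBd (g := toB6 (geo9Y x) R₀ H₀) 𝔬.blkW 𝔬.blk (JcoKH x.toKIdx (trBasis N) B cfg μ U)
      (fun y y' => cR39 (trBasis N) * Real.exp (δJ * rJ d ℓ) * Real.exp (-(δJ * (geo9Y x).dist y y'))) := fun μ => by
    rw [hblk, hblkW]
    exact blockBd_JcoKH x.toKIdx (trBasis N) B cfg hβ1 (cfg_contracting_of_mem x.toKIdx cfg hUG) hδJ R₀ H₀ μ
  have hPr : ∀ ν, BlockBd (g := toB6 (geo9Y x) R₀ H₀) 𝔬.blk 𝔬.blkY (sliceProjK (κ := TrIdx N) ν)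
      (fun y y' => (1 : ℝ) * Real.exp (-(δJ * (geo9Y x).dist y y'))) := fun ν => by
    rw [hblk, hblkY]
    exact blockBd_sliceProjK x.toKIdx R₀ H₀ (blkBK x.toKIdx bI) ν
  have hB₄' : (Fintype.card (Fin (d + 1)) : ℝ) ^ 2 * (1 * (B₂ * (cR39 (trBasis N) * Real.exp (δJ * rJ d ℓ)) * c) * c) ≤ B₄ := by
    rw [Fintype.card_fin, Nat.cast_add, Nat.cast_one]; exact hB₄
  exact dGDv_l2_of_l4m hG hrow hB₂ (constJ_nonneg δJ) zero_le_one hc hρ hρ₁ hρJ hρJ hB₄' hDv' hD' hl4m hJL2 hPr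

/-! ## §3 The Hölder probe of G₀D_U, any carrier -/

/-- ★★ **`Letters313HZ.pXDv` AT THE PINS, ANY CARRIER (= the certificate's displayed `hpXDv` at one β)** — Φ^X_β∘G₀∘D_U : 𝔠_W⁽⁰⁾ → 𝔠_P^{(β−1)} with
`Bx ≥ (d+1)·B_h·C_J·c`, `0 ≤ δ₃ ≤ δ₀`, `δ₃ + σ ≤ δ_J`, from the DERIVED slice-diagonal right-probe member of `Thm33G0Dir.h43R`'s shape (relabelled to the direction
letters by `B9Thm313WholeDvProbeAtPins.h43Rd_of_pins`), at a record whose `blk ∕ blkY ∕ blkW ∕ G0 ∕ Dstar ∕ Dv` and probes `ΦX ∕ blkPX` are pinned as in the certificate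
(any probe transporter `gU`, weights `w ∕ w₀`, anchors `blkPK bP` — fits `holderProbesKA`), every member, every SU(N)-valued `cfg U` of any carrier (dag-n06-l's
`pXDv_pins`, carrier-generic). [cite: Balaban1985BackgroundPropagators, (3.43) p.398 + (3.40) p.397 + (3.133) p.422 + (3.3) p.390 + (3.35) p.396; Balaban1984PropagatorsII, (2.51)–(2.56) pp.232–233 + Lemma 2.1 (2.61) p.234] -/
theorem pXDv_pinsB (x : MemberY d ℓ hd hL b₀ b₁ Mstar) {bI : FBondY x.toKIdx → IBondY x.toKIdx}
    (hβ1 : ∀ f : FBondY x.toKIdx, (geomT x.D).dist (β x.hN x.D x.hk (bI f)) (blkV1 x.hN x.D f) ≤ 1)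
    {Z : Type} [Fintype Z] {B : B9.Backgrounds} {cfg : B.Cfg → CfgY (Matrix (Fin N) (Fin N) ℂ) x.toKIdx}
    {U : B.Cfg} (hUG : ∀ μ z, cfg U μ z ∈ specialUnitaryUnits (Fin N))
    {R₀ : ℝ} {H₀ : Prop} (hG : GeoOK (geo9Y x)) {σ c : ℝ} (hrow : RowSum (toB6 (geo9Y x) R₀ H₀) σ c)
    (𝔬 : Ops (geo9Y x) B (XBK (TrIdx N) x.toKIdx) (XBK (TrIdx N) x.toKIdx) Z (XSK (TrIdx N) x.toKIdx))
    {PY : Type} (𝔭 : HolderProbes (geo9Y x) B (XBK (TrIdx N) x.toKIdx) (XBK (TrIdx N) x.toKIdx) (PK (FBondY x.toKIdx) (Fin (d + 1)) (TrIdx N)) PY)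
    (O : BondOpY (Matrix (Fin N) (Fin N) ℂ) x.toKIdx) {bP : FBondY x.toKIdx → IBondY x.toKIdx}
    (gU : FBondY x.toKIdx → FBondY x.toKIdx → (Matrix (Fin N) (Fin N) ℂ)ˣ)
    (w : ℝ → FBondY x.toKIdx → FBondY x.toKIdx → ℝ) (w₀ : ℝ → FBondY x.toKIdx → ℝ)
    (hblk : 𝔬.blk = blkBK x.toKIdx bI) (hblkY : 𝔬.blkY = blkBK x.toKIdx bI) (hblkW : 𝔬.blkW = blkSK x.toKIdx (sIK x.toKIdx bI))
    (hG0 : 𝔬.G0 U = GcoK x.toKIdx (trBasis N) B cfg O U)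
    (hDs : 𝔬.Dstar U = DscoK x.toKIdx (trBasis N) B cfg U)
    (hDv : 𝔬.Dv U = DvcoKH x.toKIdx (trBasis N) B cfg U)
    {Dds : Fin (d + 1) → Module.End ℝ (XBK (TrIdx N) x.toKIdx → ℝ)}
    (hDds : Dds = fun μ => coordOpK (trBasis N) (fun _ : Fin (d + 1) => cdsBₗ x.toKIdx (cfg U) μ))
    {βH : ℝ} (hΦX : 𝔭.ΦX U βH = probeK (trBasis N) gU (w βH) (w₀ βH))
    (hPX : 𝔭.blkPX = blkPK bP)
    {Bh δ₀ δJ Bx δ₃ : ℝ} (hBh : 0 ≤ Bh) (hδJ : 0 ≤ δJ) (hδ₃ : 0 ≤ δ₃) (hδ₃0 : δ₃ ≤ δ₀) (hδ₃J : δ₃ + σ ≤ δJ)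
    (hBx : ((d : ℝ) + 1) * (Bh * (cR39 (trBasis N) * Real.exp (δJ * rJ d ℓ)) * c) ≤ Bx)
    (h43R : HasMajorantHom (g := toB6 (geo9Y x) R₀ H₀) 𝔬.blkY 𝔭.blkPX (𝔭.ΦX U βH ∘ₗ (𝔬.G0 U ∘ₗ 𝔬.Dstar U))
      (fun (a b : (geo9Y x).Site) => Bh * (geo9Y x).len a ^ (1 - βH) * Real.exp (-(δ₀ * (geo9Y x).dist a b)))) :
    HasMaj (cNormR R₀ H₀ 𝔬.blkW hG.lenle 0) (cNormR R₀ H₀ 𝔭.blkPX hG.lenle (βH - 1)) ((𝔭.ΦX U βH ∘ₗ 𝔬.G0 U) ∘ₗ 𝔬.Dv U)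
      (fun a b => Bx * Real.exp (-(δ₃ * (geo9Y x).dist a b))) := by
  letI : Fintype (geo9K x.toKIdx).Site := (inferInstance : Fintype (geo9Y x).Site)
  have hDv' : 𝔬.Dv U = ∑ μ, Dds μ ∘ₗ JcoKH x.toKIdx (trBasis N) B cfg μ U := by
    rw [hDv, hDds]
    exact DvcoKH_eq_sum x.toKIdx (trBasis N) B cfg U
  have hJ : ∀ μ, HasMaj (cNorm R₀ H₀ 𝔬.blkW hG.lenle 0) (cNorm R₀ H₀ 𝔬.blk hG.lenle 0) (JcoKH x.toKIdx (trBasis N) B cfg μ U)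
      (fun a b => cR39 (trBasis N) * Real.exp (δJ * rJ d ℓ) * Real.exp (-(δJ * (geo9Y x).dist a b))) := fun μ => by
    rw [hblk, hblkW]
    exact hasMaj_JcoKH x.toKIdx (trBasis N) B cfg hβ1 (cfg_contracting_of_mem x.toKIdx cfg hUG) hδJ hG.lenle μ
  -- the directional right-probe member by slice relabelling (dag-n06-w5 ∕ dag-n06-l)
  have h43Rd : ∀ μ, HasMajorantHom (g := toB6 (geo9Y x) R₀ H₀) 𝔬.blk 𝔭.blkPX (𝔭.ΦX U βH ∘ₗ (𝔬.G0 U ∘ₗ Dds μ))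
      (fun (a b : (geo9Y x).Site) => Bh * (geo9Y x).len a ^ (1 - βH) * Real.exp (-(δ₀ * (geo9Y x).dist a b))) := by
    intro μ
    rw [hPX, hΦX]
    rw [hPX, hΦX] at h43R
    exact h43Rd_of_pins x.toKIdx (trBasis N) B cfg O 𝔬 gU (w βH) (w₀ βH) hblk hblkY hG0 hDs hDds h43R μ
  have hBx' : (Fintype.card (Fin (d + 1)) : ℝ) * (Bh * (cR39 (trBasis N) * Real.exp (δJ * rJ d ℓ)) * c) ≤ Bx := by
    rw [Fintype.card_fin, Nat.cast_add, Nat.cast_one]; exact hBx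
  exact pXDv_of_h43Rd hG hrow hBh (mul_nonneg (cR39_nonneg _) (Real.exp_nonneg _)) hδ₃ hδ₃0 hδ₃J hBx' hDv' h43Rd hJ

end Literature.MathematicalPhysics.QuantumFieldTheory.Balaban1983to89.B9Thm313WholeDvAtPinsR

end
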